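import Summits.CriticalPhenomena.PercolationContinuityZ3.Theorems.SahiMasterFamilyUCBernstein
import Summits.CriticalPhenomena.PercolationContinuityZ3.Theorems.SahiMasterFamilyPatchSingle

/-!
# Conjecture (B) holds on its first layer, every order: `layerSum 𝒰 j ≥ 0` for every type `j` that uses one family once
# and another family for all remaining labels

Unit `prim-masterthm-p4` (gen 21; crux anchor stmt-CriticalPhenomena-4575, helper work; memo
`run/shared/lean/prim/prim-masterthm/prim-masterthm-p4/P4-GEN21-REPORT.md` §3).  Bridge between `…UCBernstein` (patchwork decomposition, typed
conjecture (B) `UCBernsteinNonneg`, layer sums `layerSum`) and `…PatchSingle` (single-label patchworks are Sahi-nonnegative, via the free index).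

**THEOREM** `layerSum_nonneg_of_single`: for union-closed families `𝒰_z ∋ univ` (`z ∈ α`) of subsets of `Fin (n+1)` and a type `j : α → ℕ` with `j y = 1` and
`j z = 0` for every `z ∉ {x, y}`, the layer sum `N_j = Σ_{ℓ of type j} Φ_{n+1}(1_{ℱ_ℓ})` is `≥ 0` — indeed every labelling of that type has exactly
one element `v` labelled `y`, its patchwork tests the sets rooted at `v` against `𝒰_y` and all other sets against `𝒰_x`, and such single-label patchworks are
nonnegative termwise (`PatchSingle.phiSet_patchSingle_nonneg`).  With `layerSum_unit_nonneg` ((B) for one family = (V)) these are the layers of (B) that are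
theorems for every order; from two labels of each family on, single patchworks can be negative and (B) is open.  HONEST FRAMING: (B), `UCHullNonneg k`
(k ≥ 8), Sahi's `C_k` and the master theorem remain OPEN.  Axioms standard. [this work]
-/

noncomputable section

open scoped Classical

namespace Summit.CriticalPhenomena.PercolationContinuityZ3.Theorems

namespace UCBernstein

open Finset Function
open Literature.Combinatorics.Sahi2008
open PrincipalCapBeta (phiSet)

variable {n : ℕ}

/-- `Φ_{n+1}` only sees the values of a set function on NONEMPTY sets (blocks of a set partition are nonempty). [this work] -/
theorem phiSet_congr_nonempty (f g : Finset (Fin (n + 1)) → ℝ) (h : ∀ S, S.Nonempty → f S = g S) :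
    phiSet (n + 1) f = phiSet (n + 1) g := by
  unfold PrincipalCapBeta.phiSet
  refine sum_congr rfl fun c _ => ?_
  congr 1
  refine prod_congr rfl fun i _ => ?_
  rw [h _ (block_nonempty c i)]

/-- A labelling in which every element other than `v` carries the label `x` and `v` carries `y`: its patchwork is the single-label patchwork
(`𝒰_y` on the sets rooted at `v`, `𝒰_x` elsewhere), on nonempty sets. [this work] -/
theorem patchInd_eq_single {α : Type} (𝒰 : α → Finset (Finset (Fin (n + 1)))) (ℓ : Fin (n + 1) → α) {x y : α} {v : Fin (n + 1)}
    (hv : ℓ v = y) (hx : ∀ i, i ≠ v → ℓ i = x) {S : Finset (Fin (n + 1))} (hS : S.Nonempty) :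
    patchInd 𝒰 ℓ S = if (v ∈ S ∧ ∀ i ∈ S, v ≤ i) then (if S ∈ 𝒰 y then (1 : ℝ) else 0) else (if S ∈ 𝒰 x then (1 : ℝ) else 0) := by
  rw [patchInd_eq 𝒰 ℓ hS]
  by_cases hroot : (v ∈ S ∧ ∀ i ∈ S, v ≤ i)
  · have hrep : rep S = v := le_antisymm (rep_le hroot.1) (hroot.2 _ (rep_mem hS))
    rw [if_pos hroot, hrep, hv]
  · have hrep : rep S ≠ v := by
      intro h
      exact hroot ⟨h ▸ rep_mem hS, fun i hi => h ▸ rep_le hi⟩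
    rw [if_neg hroot, hx _ hrep]

/-- **(B) on its first layer, every order.**  If the type `j` uses the label `y` exactly once and only the labels `x, y`, then
`layerSum 𝒰 j ≥ 0` for union-closed `𝒰_z ∋ univ`. [this work] -/
theorem layerSum_nonneg_of_single {α : Type} [Fintype α] (𝒰 : α → Finset (Finset (Fin (n + 1))))
    (hUC : ∀ z, ∀ A ∈ 𝒰 z, ∀ A' ∈ 𝒰 z, A ∪ A' ∈ 𝒰 z) (htop : ∀ z, univ ∈ 𝒰 z)
    {x y : α} (j : α → ℕ) (hjy : j y = 1) (hj0 : ∀ z, z ≠ x → z ≠ y → j z = 0) :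
    0 ≤ layerSum 𝒰 j := by
  unfold layerSum
  refine sum_nonneg fun ℓ hℓ => ?_
  have hty : ltype ℓ = j := (mem_filter.1 hℓ).2
  -- the unique element labelled `y`
  have hcard : (univ.filter fun i : Fin (n + 1) => ℓ i = y).card = 1 := by
    have := congrFun hty y
    unfold ltype at this
    rw [this, hjy]
  obtain ⟨v, hv⟩ := card_eq_one.1 hcard
  have hvy : ℓ v = y := by
    have : v ∈ univ.filter fun i : Fin (n + 1) => ℓ i = y := by rw [hv]; exact mem_singleton_self v
    exact (mem_filter.1 this).2
  have hx : ∀ i, i ≠ v → ℓ i = x := by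
    intro i hi
    by_contra hne
    by_cases hiy : ℓ i = y
    · have : i ∈ univ.filter fun i' : Fin (n + 1) => ℓ i' = y := mem_filter.2 ⟨mem_univ _, hiy⟩
      rw [hv, mem_singleton] at this
      exact hi this
    · have h0 : j (ℓ i) = 0 := hj0 (ℓ i) hne hiy
      have hc : (univ.filter fun i' : Fin (n + 1) => ℓ i' = ℓ i).card = 0 := by
        have := congrFun hty (ℓ i)
        unfold ltype at this
        rw [this, h0]
      have : i ∈ univ.filter fun i' : Fin (n + 1) => ℓ i' = ℓ i := mem_filter.2 ⟨mem_univ _, rfl⟩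
      rw [card_eq_zero.1 hc] at this
      exact absurd this (Finset.notMem_empty i)
  rw [phiSet_congr_nonempty (patchInd 𝒰 ℓ) _ (fun S hS => patchInd_eq_single 𝒰 ℓ hvy hx hS)]
  exact PatchSingle.phiSet_patchSingle_nonneg (𝒰 x) (𝒰 y) (hUC x) (htop x) (htop y) v

end UCBernstein

end Summit.CriticalPhenomena.PercolationContinuityZ3.Theorems
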